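import Summits.Ventures.PercRepro.Support
import Summits.Ventures.PercRepro.Cluster

/-!
# Revealing the edges at a vertex set: the toolbox behind the van den Berg–Kahn inequality

For Bernoulli bond percolation on a finite multigraph `G`, a vertex set `Z` and the set `K` of
edges incident to `Z`, this file provides

(The splitting identities `prob_eq_sum_keepOn` / `expect_eq_sum_keepOn` — reveal the
configuration `ζ` of the edges of `K` with weight `keepOn p K`, then percolate on the remaining
edges with `zeroOn p K` — and the pointwise lattice lemmas `sup_apply_eq_true_iff` /
`inf_apply_eq_true_iff` live in `Support.lean` / `Conditioning.lean`.)

* `G.ClusterMono s f` / `G.ClusterAnti s f`: functions determined by the open cluster of `s` and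
  increasing / decreasing in it (the function analogue of `G.ClusterDet s`);
* `G.exposed Z ζ`, the vertices outside `Z` touched by a `ζ`-open edge, and the two **path
  lemmas** `conn_of_conn_sup_of_avoid`, `conn_sup_of_closed_incident` describing the open cluster
  of a vertex `s ∉ Z` in `ζ ⊔ ω` when `ω` is closed on `K`;
* `G.sup_mem_sepAllEvent_iff`, `G.cluster_sup_eq_of_mem_sepAllEvent`: for `ζ` supported on `K`
  and `ω` closed on `K`, `ζ ⊔ ω ∈ R_W` iff `ω ∈ R_{(W \ Z) ∪ exposed Z ζ}`, and then `s` has the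
  same open cluster in `ζ ⊔ ω` and in `ω` (`R_X = G.sepAllEvent s X`);
* `G.prob_zeroOn_sup_eq` / `G.expect_zeroOn_sup_eq`: hence, for `D` cluster-determined
  (`G.ClusterDet s D`) resp. `f` a function of the cluster, and `Z ⊆ W`, under `zeroOn p K` the
  event `{ω | ζ ⊔ ω ∈ D ∩ R_W}` has the probability of `D ∩ R_{(W \ Z) ∪ exposed Z ζ}`, and
  `ω ↦ (1_{R_W} f)(ζ ⊔ ω)` the expectation of `1_{R_{(W \ Z) ∪ exposed Z ζ}} f`.

These are the ingredients of the induction step of van den Berg–Kahn (2001) / van den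
Berg–Häggström–Kahn (2006), Theorem 1.1, proved in `TheoremW.lean`.
-/

namespace PercRepro

open Finset

/-! ### The vertices exposed by a configuration at `Z`; path lemmas -/

namespace MultiGraph

variable {V E : Type*} (G : MultiGraph V E)

/-! ### Functions determined by, and monotone in, the open cluster of a vertex -/

/-- `G.ClusterMono s f`: the function `f` is determined by the open cluster `C_s` of `s` and
is increasing in it — `C_s(ω) ⊆ C_s(ω')` implies `f ω ≤ f ω'`.  (The function analogue of
`G.ClusterDet s`.) -/
def ClusterMono (s : V) (f : Config E → ℝ) : Prop :=
  ∀ ⦃ω ω' : Config E⦄, G.cluster ω s ⊆ G.cluster ω' s → f ω ≤ f ω'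

/-- `G.ClusterAnti s f`: `f` is determined by the open cluster of `s` and decreasing in it. -/
def ClusterAnti (s : V) (f : Config E → ℝ) : Prop :=
  ∀ ⦃ω ω' : Config E⦄, G.cluster ω s ⊆ G.cluster ω' s → f ω' ≤ f ω

variable {G}

/-- A cluster-increasing function is monotone on configurations. -/
theorem ClusterMono.monotone {s : V} {f : Config E → ℝ} (hf : G.ClusterMono s f) :
    Monotone f :=
  fun _ _ h => hf (G.cluster_mono h s)

/-- A cluster-increasing function depends only on the cluster. -/
theorem ClusterMono.eq_of_cluster_eq {s : V} {f : Config E → ℝ} (hf : G.ClusterMono s f)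
    {ω ω' : Config E} (h : G.cluster ω s = G.cluster ω' s) : f ω = f ω' :=
  le_antisymm (hf h.subset) (hf h.symm.subset)

/-- A cluster-decreasing function depends only on the cluster. -/
theorem ClusterAnti.eq_of_cluster_eq {s : V} {f : Config E → ℝ} (hf : G.ClusterAnti s f)
    {ω ω' : Config E} (h : G.cluster ω s = G.cluster ω' s) : f ω = f ω' :=
  le_antisymm (hf h.symm.subset) (hf h.subset)

/-- Products of nonnegative cluster-increasing functions are cluster-increasing. -/
theorem ClusterMono.mul {s : V} {f g : Config E → ℝ} (hf : G.ClusterMono s f)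
    (hg : G.ClusterMono s g) (hf0 : 0 ≤ f) (hg0 : 0 ≤ g) : G.ClusterMono s (f * g) :=
  fun _ ω' h => mul_le_mul (hf h) (hg h) (hg0 _) (hf0 ω')

/-- Constants are cluster-increasing. -/
theorem clusterMono_const (s : V) (c : ℝ) : G.ClusterMono s (fun _ => c) := fun _ _ _ => le_rfl

/-- `c - h` is cluster-increasing when `h` is cluster-decreasing. -/
theorem ClusterAnti.const_sub {s : V} {h : Config E → ℝ} (hh : G.ClusterAnti s h) (c : ℝ) :
    G.ClusterMono s (fun ω => c - h ω) :=
  fun _ _ hle => sub_le_sub_left (hh hle) c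

/-- The indicator of a cluster-determined event is cluster-increasing. -/
theorem ClusterDet.clusterMono_indicator {s : V} {A : Set (Config E)} (hA : G.ClusterDet s A) :
    G.ClusterMono s (A.indicator 1) := by
  intro ω ω' h
  by_cases hω : ω ∈ A
  · rw [Set.indicator_of_mem hω, Set.indicator_of_mem (hA h hω)]
    exact le_rfl
  · rw [Set.indicator_of_notMem hω]
    exact Set.indicator_nonneg (fun _ _ => zero_le_one) _

variable (G)

/-- `G.exposed Z ζ`: the vertices outside `Z` that are endpoints of an edge open in `ζ`
(for `ζ` supported on the edges incident to `Z`: the vertices outside `Z` joined to `Z` by a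
`ζ`-open edge). -/
def exposed (Z : Set V) (ζ : Config E) : Set V :=
  {v | v ∉ Z ∧ ∃ e, ζ e = true ∧ (G.fst e = v ∨ G.snd e = v)}

/-- `exposed` of a meet is contained in the intersection. -/
theorem exposed_inf_subset (Z : Set V) (ζ ζ' : Config E) :
    G.exposed Z (ζ ⊓ ζ') ⊆ G.exposed Z ζ ∩ G.exposed Z ζ' := by
  rintro v ⟨hv, e, he, hend⟩
  have he' : ζ e = true ∧ ζ' e = true := inf_apply_eq_true_iff.1 he
  exact ⟨⟨hv, e, he'.1, hend⟩, ⟨hv, e, he'.2, hend⟩⟩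

/-- `exposed` of a join is the union. -/
theorem exposed_sup (Z : Set V) (ζ ζ' : Config E) :
    G.exposed Z (ζ ⊔ ζ') = G.exposed Z ζ ∪ G.exposed Z ζ' := by
  ext v
  simp only [exposed, Set.mem_setOf_eq, Set.mem_union, sup_apply_eq_true_iff]
  constructor
  · rintro ⟨hv, e, (he | he), hend⟩
    · exact Or.inl ⟨hv, e, he, hend⟩
    · exact Or.inr ⟨hv, e, he, hend⟩
  · rintro (⟨hv, e, he, hend⟩ | ⟨hv, e, he, hend⟩)
    · exact ⟨hv, e, Or.inl he, hend⟩
    · exact ⟨hv, e, Or.inr he, hend⟩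

variable {G}

/-- **Path lemma I.** If every `ζ`-open edge is incident to `Z` and `s` is separated from `Z`
in `ζ ⊔ ω`, then every vertex reachable from `s` in `ζ ⊔ ω` is reachable in `ω` alone. -/
theorem conn_of_conn_sup_of_avoid {s : V} {Z : Set V} {ζ ω : Config E}
    (hζ : ∀ e, ζ e = true → G.fst e ∈ Z ∨ G.snd e ∈ Z)
    (hav : ∀ z ∈ Z, ¬ G.Conn (ζ ⊔ ω) s z) {v : V} (h : G.Conn (ζ ⊔ ω) s v) :
    G.Conn ω s v := by
  refine Conn.induction (motive := fun v => G.Conn ω s v) (Conn.refl G ω s)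
    (fun {a b} hsa hab ha => ?_) h
  obtain ⟨e, he, hend⟩ := hab
  have he' : ζ e = true ∨ ω e = true := sup_apply_eq_true_iff.1 he
  rcases he' with hζe | hωe
  · exfalso
    have hsb : G.Conn (ζ ⊔ ω) s b := hsa.trans (Conn.of_openAdj ⟨e, he, hend⟩)
    rcases hζ e hζe with hz | hz
    · rcases hend with ⟨h1, _⟩ | ⟨h1, _⟩
      · exact hav _ hz (h1 ▸ hsa)
      · exact hav _ hz (h1 ▸ hsb)
    · rcases hend with ⟨_, h2⟩ | ⟨_, h2⟩
      · exact hav _ hz (h2 ▸ hsb)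
      · exact hav _ hz (h2 ▸ hsa)
  · exact ha.trans (Conn.of_openAdj ⟨e, hωe, hend⟩)

/-- **Path lemma II.** If `ω` is closed on every edge incident to `Z`, `s ∉ Z`, and `s` is
`ω`-separated from every vertex exposed by `ζ`, then every vertex reachable from `s` in
`ζ ⊔ ω` lies outside `Z` and is reachable in `ω` alone. -/
theorem conn_sup_of_closed_incident {s : V} {Z : Set V} (hs : s ∉ Z) {ζ ω : Config E}
    (hω : ∀ e, ω e = true → G.fst e ∉ Z ∧ G.snd e ∉ Z)
    (hex : ∀ y ∈ G.exposed Z ζ, ¬ G.Conn ω s y) {v : V} (h : G.Conn (ζ ⊔ ω) s v) :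
    v ∉ Z ∧ G.Conn ω s v := by
  refine Conn.induction (motive := fun v => v ∉ Z ∧ G.Conn ω s v) ⟨hs, Conn.refl G ω s⟩
    (fun {a b} _ hab ha => ?_) h
  obtain ⟨haZ, hsa⟩ := ha
  obtain ⟨e, he, hend⟩ := hab
  have he' : ζ e = true ∨ ω e = true := sup_apply_eq_true_iff.1 he
  rcases he' with hζe | hωe
  · exfalso
    refine hex a ⟨haZ, e, hζe, ?_⟩ hsa
    rcases hend with ⟨h1, _⟩ | ⟨_, h1⟩
    · exact Or.inl h1
    · exact Or.inr h1
  · refine ⟨?_, hsa.trans (Conn.of_openAdj ⟨e, hωe, hend⟩)⟩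
    rcases hend with ⟨_, h2⟩ | ⟨h2, _⟩
    · exact h2 ▸ (hω e hωe).2
    · exact h2 ▸ (hω e hωe).1

/-- If `ω` is closed on every edge incident to `Z` and `s ∉ Z`, then `s` reaches nothing in
`Z`. -/
theorem not_mem_of_conn_of_closed_incident {s : V} {Z : Set V} (hs : s ∉ Z) {ω : Config E}
    (hω : ∀ e, ω e = true → G.fst e ∉ Z ∧ G.snd e ∉ Z) {v : V} (h : G.Conn ω s v) : v ∉ Z := by
  have h' : G.Conn (⊥ ⊔ ω) s v := by simpa using h
  exact (conn_sup_of_closed_incident hs hω (fun y hy => by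
    obtain ⟨_, e, he, _⟩ := hy
    simp at he) h').1

/-- For `ω` closed on the edges incident to `Z` and `s ∉ Z`, avoiding `W` is avoiding `W \ Z`. -/
theorem mem_sepAllEvent_iff_of_closed_incident {s : V} {Z : Set V} (hs : s ∉ Z) {ω : Config E}
    (hω : ∀ e, ω e = true → G.fst e ∉ Z ∧ G.snd e ∉ Z) (W : Set V) :
    ω ∈ G.sepAllEvent s W ↔ ω ∈ G.sepAllEvent s (W \ Z) := by
  constructor
  · intro h x hx
    exact h x hx.1
  · intro h x hx hc
    exact h x ⟨hx, not_mem_of_conn_of_closed_incident hs hω hc⟩ hc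

/-- If every `ζ`-open edge is incident to `Z` and `s` is separated from `Z` in `ζ ⊔ ω`, the open
cluster of `s` in `ζ ⊔ ω` is its open cluster in `ω`. -/
theorem cluster_sup_eq_of_avoid {s : V} {Z : Set V} {ζ ω : Config E}
    (hζ : ∀ e, ζ e = true → G.fst e ∈ Z ∨ G.snd e ∈ Z)
    (hav : ∀ z ∈ Z, ¬ G.Conn (ζ ⊔ ω) s z) : G.cluster (ζ ⊔ ω) s = G.cluster ω s :=
  Set.Subset.antisymm (fun _ hv => conn_of_conn_sup_of_avoid hζ hav hv)
    (G.cluster_mono le_sup_right s)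

/-- **Revealing the edges at `Z`, set level.** Let `K` be the set of edges incident to `Z`,
`s ∉ Z`, `Z ⊆ W`, `ζ` supported on `K` and `ω` closed on `K`.  Then `ζ ⊔ ω ∈ R_W` iff
`ω ∈ R_{(W \ Z) ∪ exposed Z ζ}`. -/
theorem sup_mem_sepAllEvent_iff (s : V) {Z : Set V} (hs : s ∉ Z) {K : Finset E}
    (hK : ∀ e, e ∈ K ↔ (G.fst e ∈ Z ∨ G.snd e ∈ Z)) {W : Set V} (hZW : Z ⊆ W) {ζ ω : Config E}
    (hζ : ∀ e ∉ K, ζ e = false) (hω : ∀ e ∈ K, ω e = false) :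
    ζ ⊔ ω ∈ G.sepAllEvent s W ↔ ω ∈ G.sepAllEvent s ((W \ Z) ∪ G.exposed Z ζ) := by
  have hωZ : ∀ e, ω e = true → G.fst e ∉ Z ∧ G.snd e ∉ Z := by
    intro e he
    have hnK : e ∉ K := fun hK' => by simp [hω e hK'] at he
    rw [hK] at hnK
    exact ⟨fun h => hnK (Or.inl h), fun h => hnK (Or.inr h)⟩
  have hζZ : ∀ e, ζ e = true → G.fst e ∈ Z ∨ G.snd e ∈ Z := by
    intro e he
    by_contra hcon
    have hnK : e ∉ K := fun hK' => hcon ((hK e).1 hK')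
    simp [hζ e hnK] at he
  constructor
  · intro hav
    have hav' : ∀ z ∈ Z, ¬ G.Conn (ζ ⊔ ω) s z := fun z hz => hav z (hZW hz)
    intro x hx hconn
    rcases hx with ⟨hxW, _⟩ | ⟨_, e, he, hend⟩
    · exact hav x hxW (hconn.mono le_sup_right)
    · have hsx : G.Conn (ζ ⊔ ω) s x := hconn.mono le_sup_right
      have he' : (ζ ⊔ ω) e = true := sup_apply_eq_true_iff.2 (Or.inl he)
      have hadj : G.OpenAdj (ζ ⊔ ω) (G.fst e) (G.snd e) := G.openAdj_of_open e he'
      have h1 : G.Conn (ζ ⊔ ω) s (G.fst e) ∧ G.Conn (ζ ⊔ ω) s (G.snd e) := by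
        rcases hend with h | h
        · exact ⟨h ▸ hsx, (h ▸ hsx).trans (Conn.of_openAdj hadj)⟩
        · exact ⟨(h ▸ hsx).trans (Conn.of_openAdj hadj.symm), h ▸ hsx⟩
      rcases hζZ e he with hz | hz
      · exact hav' _ hz h1.1
      · exact hav' _ hz h1.2
  · intro hav
    have hex : ∀ y ∈ G.exposed Z ζ, ¬ G.Conn ω s y := fun y hy => hav y (Or.inr hy)
    intro x hx hconn
    obtain ⟨hxZ, hωx⟩ := conn_sup_of_closed_incident hs hωZ hex hconn
    exact hav x (Or.inl ⟨hx, hxZ⟩) hωx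

/-- Under the hypotheses of `sup_mem_sepAllEvent_iff`, if `ζ ⊔ ω ∈ R_W` then the open cluster
of `s` in `ζ ⊔ ω` is its open cluster in `ω`. -/
theorem cluster_sup_eq_of_mem_sepAllEvent (s : V) {Z : Set V} {K : Finset E}
    (hK : ∀ e, e ∈ K ↔ (G.fst e ∈ Z ∨ G.snd e ∈ Z)) {W : Set V} (hZW : Z ⊆ W) {ζ ω : Config E}
    (hζ : ∀ e ∉ K, ζ e = false) (hav : ζ ⊔ ω ∈ G.sepAllEvent s W) :
    G.cluster (ζ ⊔ ω) s = G.cluster ω s := by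
  have hζZ : ∀ e, ζ e = true → G.fst e ∈ Z ∨ G.snd e ∈ Z := by
    intro e he
    by_contra hcon
    have hnK : e ∉ K := fun hK' => hcon ((hK e).1 hK')
    simp [hζ e hnK] at he
  exact cluster_sup_eq_of_avoid hζZ fun z hz => hav z (hZW hz)

section Prob

variable [Fintype E] [DecidableEq E]

/-- **Revealing the edges at `Z`.** Let `K` be the set of edges incident to `Z`, `s ∉ Z`,
`D` cluster-determined, `Z ⊆ W`, and `ζ` a configuration supported on `K`.  Under `zeroOn p K`
(so that a.s. every edge of `K` is closed), `ζ ⊔ ω ∈ D ∩ R_W` iff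
`ω ∈ D ∩ R_{(W \ Z) ∪ exposed Z ζ}`; hence the two events have the same probability. -/
theorem prob_zeroOn_sup_eq (s : V) {Z : Set V} (hs : s ∉ Z) {K : Finset E}
    (hK : ∀ e, e ∈ K ↔ (G.fst e ∈ Z ∨ G.snd e ∈ Z)) (p : E → ℝ) {D : Set (Config E)}
    (hD : G.ClusterDet s D) {W : Set V} (hZW : Z ⊆ W) {ζ : Config E}
    (hζ : ∀ e ∉ K, ζ e = false) :
    prob (zeroOn p K) {ω | ζ ⊔ ω ∈ D ∩ G.sepAllEvent s W} =
      prob (zeroOn p K) (D ∩ G.sepAllEvent s ((W \ Z) ∪ G.exposed Z ζ)) := by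
  apply prob_congr_of_support
  intro ω hω
  have hωK : ∀ e ∈ K, ω e = false := closedOn_of_weight_zeroOn_ne_zero hω
  simp only [Set.mem_setOf_eq, Set.mem_inter_iff]
  rw [G.sup_mem_sepAllEvent_iff s hs hK hZW hζ hωK]
  constructor
  · rintro ⟨hDsup, hav⟩
    have hcl := G.cluster_sup_eq_of_mem_sepAllEvent s hK hZW hζ
      ((G.sup_mem_sepAllEvent_iff s hs hK hZW hζ hωK).2 hav)
    exact ⟨hD hcl.subset hDsup, hav⟩
  · rintro ⟨hDω, hav⟩
    exact ⟨hD (G.cluster_mono le_sup_right s) hDω, hav⟩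

/-- **Revealing the edges at `Z`, function form.** For `f` determined by the cluster of `s`
(`G.ClusterMono s f`), `Z ⊆ W` and `ζ` supported on the edges `K` at `Z`, under `zeroOn p K`
the function `ω ↦ (1_{R_W} f)(ζ ⊔ ω)` has the expectation of `1_{R_{(W \ Z) ∪ exposed Z ζ}} f`. -/
theorem expect_zeroOn_sup_eq (s : V) {Z : Set V} (hs : s ∉ Z) {K : Finset E}
    (hK : ∀ e, e ∈ K ↔ (G.fst e ∈ Z ∨ G.snd e ∈ Z)) (p : E → ℝ) {f : Config E → ℝ}
    (hf : ∀ ⦃ω ω' : Config E⦄, G.cluster ω s = G.cluster ω' s → f ω = f ω') {W : Set V}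
    (hZW : Z ⊆ W) {ζ : Config E} (hζ : ∀ e ∉ K, ζ e = false) :
    expect (zeroOn p K) (fun ω => (G.sepAllEvent s W).indicator f (ζ ⊔ ω)) =
      expect (zeroOn p K) ((G.sepAllEvent s ((W \ Z) ∪ G.exposed Z ζ)).indicator f) := by
  apply expect_congr_of_support
  intro ω hω
  have hωK : ∀ e ∈ K, ω e = false := closedOn_of_weight_zeroOn_ne_zero hω
  have hiff := G.sup_mem_sepAllEvent_iff s hs hK hZW hζ hωK
  by_cases hav : ζ ⊔ ω ∈ G.sepAllEvent s W
  · rw [Set.indicator_of_mem hav, Set.indicator_of_mem (hiff.1 hav)]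
    exact hf (G.cluster_sup_eq_of_mem_sepAllEvent s hK hZW hζ hav)
  · rw [Set.indicator_of_notMem hav, Set.indicator_of_notMem (fun h => hav (hiff.2 h))]

end Prob

end MultiGraph


end PercRepro
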